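import Mathlib
import Literature.MathematicalPhysics.QuantumFieldTheory.Balaban1983to89.B16Cor3

/-!
# `Balaban1983to89.B16Cor3Scales` — [Balaban1989LargeFieldII] pp. 383–387: the SCALE INDEXING behind
"(1.89) + κ₁d_k(X) ⟹ (2.50) [III]" — the entropy hypothesis `hE : Σ_Y w(Y) ≤ Ep′·|T₁^{(k)}|` of the sibling
`B16Cor3.uvIneq_of_structure` DISCHARGED, with a k-UNIFORM `Ep′`, under each of the two printed bookkeepings of the
large-field regions present at step k: (α) tokens of finitely many classes at the CURRENT scale (B16's own: the live
region is re-covered at every step, p. 384), (β) tokens indexed by their BIRTH scale with an explicit LIVENESS HORIZON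
and SMALLNESS clause (the "global collection" of [Balaban1982Higgs2] Sect. 3.C cited by [III] p. 264 *"as in [6]"*,
and of the φ⁴₃ template, cell STEP.md A25–A26)

CITATION HEADER (lean-in-tree rule 2026-08-18).  Source: T. Bałaban, *Large field renormalization. II. Localization,
exponentiation, and bounds for the 𝐑 operation*, Commun. Math. Phys. **122**, 355–392 (1989), doi:10.1007/bf01238433
(cell paper B16 = [V]; held: `paper:balaban1989-cmp122-large-field-ii`; journal page = PDF page + 354; every quotation
below is read from the page renders `HOME/b2b-balaban-ref1/pages/1989-cmp122-large-field-II/…-p029…p033-x2.png`, pp.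
383–387), with [III] = T. Bałaban, *Convergent renormalization expansions for lattice gauge theories*, Commun. Math.
Phys. **119**, 243–285 (1988) [Balaban1988Convergent] p. 255 (2.4)–(2.5) (render `…convergent-renormalization-p013-x2.png`)
and [I] = *Renormalization group approach to lattice gauge field theories. I*, Commun. Math. Phys. **109**, 249–301
(1987) [Balaban1987RG1] p. 258 (0.30) (quoted in the sibling module `B12`).  Third module of the surge-node lineage
`B14Cor3` (gen 1: (2.50) ⇐ five named leaves) → `B16Cor3` (gen 2: leaf U2 ⇐ injective indexing by families of regions
+ weights `w` + `Σ_Y w(Y) ≤ Ep′N`, `uvIneq_of_structure`) → here (gen 3: the INDEX TYPE of the regions and `Σ_Y w(Y) ≤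
Ep′N` itself).  The sibling modules `B16`, `B16Cor3`, `B16Improved189`, `B14Cor3`, `B12TreeDecay`, `Step` are NOT
modified; `Step.Budget` (unit f2: the per-history budget `κ_j(Z)`, (1.80)–(1.88)) and `B16Improved189` (unit adv3:
the trade giving "−κ₁d_k(X)") are the typed homes of the inputs named below and are not re-typed.

(a) THE PRINTED TEXT.  p. 383 [29], the paragraph before (1.79): *"The integrals with respect to the fields A_j in
(2.21) [III], or (1.25) [IV], are estimated using the positivity properties of the quadratic forms, and we get the
factors exp O(1)|Z_j∩Ω_j|, where the volume is for the corresponding scale. Finally, the summations over the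
admissible sequences can be replaced by the factors exp O(1)(MR_j)^{−d}|Z_j|."*; (1.79): *"𝐓′_k(X)1 ≤ sup exp{Σ_{j=1}^{k}
O(1)M^dR_j^{d+1}d′_j(Z_j)} · Π_{j=1}^{k} Π_i exp(−½γ₀A₁²p₀²(g_j)(d′_j(Z_j^{(i)}) + 1) − 2p₀(g_j)) Π′ exp(−p₀(g_j)),
(1.79) where the last product is over components of Z_j satisfying the conditions (i), (ii), for which some large
fields are created during the preparatory steps. The supremum is taken over all admissible domains, satisfying all the
conditions described in the previous sections, in particular the conditions (1.76). Notice that the above inequality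
holds for all large field regions, not only for the regions satisfying the conditions (i), (ii)."*  p. 384 [30]: *"If
Z is a union of MR_j-cubes of the lattice T_ξ, ξ = L^{−j}, then we take the cover Z′ of Z by a smallest union of
LMR_{j+1}-cubes, and we add ten layers of such cubes. We denote the obtained domain by S(Z), i.e., S(Z) = Z′^{~10}.
Such a domain arises as a new large field region in our procedure, if no large fields are created in a neighborhood of
Z, more precisely in S(Z)∖Z."*; the statement: *"The factor exp(−κ_j(Z)) controls K renormalization steps, under the
assumption that no large fields are created in these steps, where the number K is the smallest positive integer having
the property that the domain S^K(Z), considered as a domain in the lattice of the scale L^{−(j+K)}, satisfies the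
conditions (i), (ii), with N = R_j. More precisely this means that κ_j(Z) ≥ Σ_{n=j+1}^{j+K} O(1)M^dR_n^{d+1}d′_n(S^{n−j}(Z)).
(1.80)"*; p. 384 last display – p. 385 [31]: *"d′_n(Z^{(n−j)}) ≤ L^{−1/2(n−j)}d′_j(Z) ≤ 2^{−(n−j)}d′_j(Z) for n − j > 1.
… Consider now the sum in (1.80). Let n₀ be the last index n such that d′_n(Z^{(n−j)}) > 0. Then S^{n₀+1−j}(Z) is
contained in a cube of the size 64MR_{n₀+1}, hence it satisfies the condition (i), and doing at most R_j further steps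
we obtain a domain satisfying both conditions (i), (ii). Thus K ≤ n₀ − j + R_j"*.  p. 387 [33] ll. 8–12 (quoted in
full in `B16Cor3`): *"… The inequality (1.80) holds quite generally for such regions, hence also an improved bound
(1.89), with the additional term −κ₁d_k(X) in the exponential. This implies the inequality (2.50) [III], hence
Corollary 3."*  [III] p. 255 [13]: *"ε_j = g_jA₀(log g_j⁻²)^{p₀} = g_jp₀(g_j); (2.4)  R_j is the smallest number of the
form L^r such, that R_j ≥ (log g_j⁻²)^r. (2.5)"*.  [I] p. 258 (0.30), fourth member (module `B12`, `Chain030Printed`):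
*"Σ_{j=1}^{k} Σ_{□∈π_j} O(1)(L^jη)^{4+α} = Σ_{j=1}^{k} O(1)(L^jη)^α M^{−4}|T_1^{(k)}|"*, i.e. `|π_j| = M⁻⁴L^{4(k−j)}|T₁^{(k)}|`
(`η = L^{−k}`; the hypotheses `hπ`, `hSites` of `B12.uvStable030_of_thm1`).

(b) THE TYPED READING.  The only hypothesis of `B16Cor3.uvIneq_of_structure` about the region type `ι` beyond
non-negativity of the weights is `hE : Σ_{Y:ι} w(Y) ≤ Ep′·N` (`N = |T₁^{(k)}|`); everything model-specific is in the
INJECTIVE indexing `fam` and the majorisation `hmaj` (leaf U1, NOT touched here).  Two index types discharge `hE`: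
(α) `ι = Fin m × 𝐃` — m CLASSES of tokens, every token a domain of the CURRENT step with weight `exp(−c_i − κ₁d_k(Y))`
(B16's bookkeeping: by the operation `S` of p. 384 a live component at step j+1 is a union of MR_{j+1}-cubes of the
current lattice; the components present at step k are the new region `Z_k`, the second-class components `Y_i` (kept
large-field) and the first-class components `X_i` (integrated out by `𝐓_k(X_i)`) of p. 378/(1.72), and by the p. 383
sentence the sums over the admissible sequences INSIDE a token are part of `𝐓′_k`/(1.79)); then `Σ w ≤ |π|·K₀·Σ_i e^{−c_i}`
(`classWeightSum_le`) and `uvIneq_of_structure_classes` gives `B16.UVIneq` with `E₊ = E′ + πc·K₀(c₀,Δ)·Σ_i e^{−c_i}`,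
`|π| ≤ πc·N` — k-UNIFORM as soon as the `c_i ≥ 0` are (e.g. `c_i = (1+β₀)⁻¹p₀(g_k) ≥ 0`): NO multi-scale entropy
arises, the history sums being inside the quoted leaf (1.79)–(1.80).  (β) `ι = Σ_{m ≤ k} (live tokens of AGE m)` —
tokens indexed by their BIRTH scale `j = k − m` (the indexing of (2.18) [III] by sequences `{Ω_j}, {Λ_j}` and of
[Balaban1982Higgs2] (3.41)–(3.47)), a scale-`j` domain system with `|π_j| ≤ πc·Λ^m·N` cubes (`Λ = L^d`; [I] p. 258),
weight `exp(−c_m − κd_j(Y))`, and an explicit SMALLNESS clause `m(log Λ + 1) + q ≤ c_m + (κ − κ₁)d_j(Y)` for every LIVE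
token (`Smallness`); then each age slice is `≤ e^{−q}e^{−m}·πc·K₀·N` (`ageSliceSum_le`, the volume `Λ^m` cancelled by
`exp_age_mul_pow`), the ages sum geometrically (`ageGeomSum_le`), `Σ w ≤ πc·K₀·e^{−q}(1 − e^{−1})⁻¹·N` (`tokenSum_le`)
and `uvIneq_of_structure_scales` gives `B16.UVIneq` with THAT `Ep′` — k-uniform by construction.  The smallness clause
is DISCHARGED from a liveness HORIZON of the printed shape "K ≤ n₀ − j + R_j" (`smallness_of_horizon`: live ⟹ `m ≤ a +
b·d_j(Y) + H_m`, `c_m ≥ (log Λ + 1)(a + H_m) + q`, `(log Λ + 1)b ≤ κ − κ₁`; the size part `n₀ − j ≤ d′_j(Z)` of the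
horizon is `age_le_size_of_halving`, from the printed halving `d′_n(Z^{(n−j)}) ≤ 2^{−(n−j)}d′_j(Z)` and "d′_{n₀} > 0"
read as `≥ 1`), and the exponent condition `c ≥ (log Λ + 1)(a + ρx^r) + q` for profiles `c = t·x^p` (`x = log g_j⁻²`,
(2.4): `p₀(g) = A₀x^{p₀}`; (2.5) + `B16Improved189.Rj_le_L_mul_pow`: `R_j ≤ L·x^r`) holds for ALL `x ≥ x₀` with an
EXPLICIT `x₀` as soon as `r < p` (`profile_domination`, `profile_domination_of_lt`; "g_j ≤ γ, γ small" =
`threshold_of_coupling_le`).  This is the cell's prose C-B16-9 («a step-(k−m) large-field event counts only while live,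
m ≲ R_{k−m} + O(1), and there L^{dm}π_{k−m}·e^{−c} ≪ 1 for r < p₀») and C-f2.7 as kernel arithmetic, and the printed
exponent relations ("2p ≥ (d+1)r" [Balaban1982Higgs2] p. 594; "2p₁ − (d+5)r₀ > p₀" p. 383; "for p₀ large, and g₁
sufficiently small" p. 385) are of exactly this `r < p` form (cell STEP.md A26, SMALLNESS.md).

WHAT IS *NOT* REPRODUCED OR ASSERTED: (1.79), (1.80), (1.89), (2.18), (2.50) themselves; WHICH bookkeeping (α)/(β) the
sentence "This implies the inequality (2.50) [III]" intends (p. 387 gives none; (α) is what pp. 383–384 support, (β) is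
what "as in [6]" [III] p. 264 and leaf U2 of `B14Cor3` name) — cell GAPS C-pv06-3; under (α) the bound of the history
SUM inside a live component by `exp(−κ_k(Z) − 2p₀(g_{j(Z)}))` rests on the single p. 383 sentence *"the summations over
the admissible sequences can be replaced by the factors exp O(1)(MR_j)^{−d}|Z_j|"* (absorbed in the first exponential
of (1.79); no display compares `(MR_j)^{−d}|Z_j|` with `R_j^{d+1}d′_j(Z_j)` — located, G-pv06-2); under (β) the weights
`c_m` left after the per-step costs of (1.80) and the comparison of the two size functions `d′_j` (MR_j-cube units,
[IV]/[V]) and `d_j` (tree length in M-cubes, [I]) behind `a, b` are hypotheses (cell GAPS G-B16-08 (a)); the cube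
counts `|π_j|` and the volume convention are the hypotheses `hπ` ([I] p. 258, cell GAPS C-adv3-6); the injective
indexing and the majorisation stay leaf U1 (cell GAPS G-adv3-1).  Instantiated with trivial data the theorems restate
their hypotheses — the content is the INDEX STRUCTURE with each leaf located and the smallness arithmetic certified.
NOTHING of the series is asserted; value = typed skeleton + located gaps + kernel arithmetic, NOT summit progress.
Unit `b2b-balaban-pv06-g3` (surge node prover #06, gen 3); companion rows: cell `GAPS.md` C-pv06-3, G-pv06-2 (this
module), C-pv06-2, G-pv06-1, C-f2.7, C-B16-9, C-adv3-6, G-B16-08, G-adv3-1; `SMALLNESS.md` S-B16.16; `DIVERGENCE.md` D-pv06.3.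
-/

namespace Literature.MathematicalPhysics.QuantumFieldTheory.Balaban1983to89.B16Cor3Scales

open Literature.MathematicalPhysics.QuantumFieldTheory.Balaban1983to89

/-! ## 1. Reading (α): finitely many classes of tokens at the CURRENT scale -/

/-- Reading (α) of the regions present at step k (p. 384 [30]: a live component is re-covered at every step by the
operation `S(Z) = Z′^{~10}`, so the new region `Z_k`, the second-class components `Y_i` and the first-class components
`X_i` of p. 378 [24] / (1.72) are all unions of cubes of the CURRENT step): tokens `(i, Y) ∈ Fin m × 𝐃_k` with
class-dependent small factors `e^{−c_i}` and the current-scale tree decay `e^{−κ₁d_k(Y)}` of the improved (1.89).  With the tree-decay input of [I] p. 257 per cube (`hTree`,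
hypothesis; discharged by name in `uvIneq_of_structure_classes`), the total weight is `≤ |π_k|·K₀·Σ_i e^{−c_i}` —
`B16Cor3.lfWeightSum_le` summed over the classes. [cite: Balaban1989LargeFieldII, p.384 (operation S) and p.387 ll.8–12] -/
theorem classWeightSum_le (S : LocDomainSys) (C : B12.CubeCover S) {m : ℕ} (c : Fin m → ℝ) (κ₁ K₀ : ℝ)
    (hTree : ∀ cb : C.Cube, ∑ X ∈ C.above cb, Real.exp (-κ₁ * S.dj X) ≤ K₀) :
    ∑ t : Fin m × S.Dom, Real.exp (-(c t.1) - κ₁ * S.dj t.2)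
      ≤ (Fintype.card C.Cube : ℝ) * K₀ * ∑ i, Real.exp (-(c i)) := by
  rw [Fintype.sum_prod_type, Finset.mul_sum]
  refine Finset.sum_le_sum fun i _ => ?_
  dsimp only
  calc ∑ Y, Real.exp (-(c i) - κ₁ * S.dj Y)
      ≤ (Fintype.card C.Cube : ℝ) * (Real.exp (-(c i)) * K₀) := B16Cor3.lfWeightSum_le S C (c i) κ₁ K₀ hTree
    _ = (Fintype.card C.Cube : ℝ) * K₀ * Real.exp (-(c i)) := by ring

/-- **(2.50)/(0.1), one run, one step, reading (α)** — `B16Cor3.uvIneq_of_structure` with the region type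
`ι = Fin m × 𝐃_k` (m classes of current-scale tokens), the weights `exp(−c_i − κ₁d_k(Y))`, the tree-decay input
DISCHARGED BY NAME (`B12TreeDecay.hTree_of_volumeLeaf`: connected families of cubes, degree bound `Δ`, volume leaf
`c₀`, `κ₁ ≥ κ₀(c₀,Δ)`), and the cube count `|π_k| ≤ πc·|T₁^{(k)}|` ([I] p. 258: `πc = M⁻⁴`; for MR_k-cubes smaller).
Conclusion: `B16.UVIneq` at every configuration with `E₋ = E₁ + ε`, `E₊ = E′ + πc·K₀(c₀,Δ)·Σ_i e^{−c_i}` — the entropy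
part of `E₊` is k-UNIFORM whenever the `c_i` are bounded below uniformly in k (for `c_i = t·p₀(g_k)`, `t ≥ 0`:
`Σ_i e^{−c_i} ≤ m`, `B16Cor3.p0Profile_nonneg`).  The remaining hypotheses (leaf H, U1 with the injective indexing
`fam` and the majorisation, L1, the all-small form and its two inputs) are those of `B16Cor3.uvIneq_of_structure`,
passed through unchanged. [cite: Balaban1989LargeFieldII, (0.1) p.356 and p.387 ll.8–12] -/
theorem uvIneq_of_structure_classes (D : B16.RunData) (k : ℕ) (R : B14Cor3.TermData D k)
    (S : LocDomainSys) (G : B12TreeDecay.CubeSystem S) {Δ : ℕ} (hΔ : G.DegreeLE Δ) {c₀ : ℝ}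
    (hV : G.VolumeLeaf c₀) {κ₁ : ℝ} (hκ : B12TreeDecay.kappa₀ c₀ Δ ≤ κ₁)
    {m : ℕ} (c : Fin m → ℝ) (πc : ℝ)
    (hπ : (Fintype.card G.toCubeCover.Cube : ℝ) ≤ πc * (D.numSites k : ℝ))
    (fam : R.Adm → Finset (Fin m × S.Dom)) (A' Rre : D.Cfg k → ℝ) (E₁ ε E' : ℝ)
    (hH : R.Holds)
    (hU1 : ∀ a V, R.term a V ≤ R.major a)
    (hinj : Function.Injective fam)
    (hmaj : ∀ a, R.major a ≤ Real.exp (E' * (D.numSites k : ℝ)) *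
      ∏ t ∈ fam a, Real.exp (-(c t.1) - κ₁ * S.dj t.2))
    (hL1 : ∀ a V, 0 ≤ R.term a V)
    (hform : ∀ V, R.term R.allSmall V = D.χ k V * Real.exp (A' V + Rre V))
    (hχ : ∀ V, 0 ≤ D.χ k V)
    (hA' : ∀ V, D.χ k V ≠ 0 →
      -(1 / (D.flow.g k) ^ 2 * D.wilsonBG k V) - E₁ * (D.numSites k : ℝ) ≤ A' V)
    (hR : ∀ V, |Rre V| ≤ ε * (D.numSites k : ℝ)) :
    ∀ V : D.Cfg k, B16.UVIneq D k V (E₁ + ε)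
      (E' + πc * B12TreeDecay.K₀ c₀ Δ * ∑ i, Real.exp (-(c i))) := by
  have hK₀ : 0 ≤ B12TreeDecay.K₀ c₀ Δ := (B12TreeDecay.K₀_pos c₀ Δ).le
  have hsum : 0 ≤ ∑ i, Real.exp (-(c i)) := Finset.sum_nonneg fun i _ => (Real.exp_pos _).le
  have hE : ∑ t : Fin m × S.Dom, Real.exp (-(c t.1) - κ₁ * S.dj t.2)
      ≤ (πc * B12TreeDecay.K₀ c₀ Δ * ∑ i, Real.exp (-(c i))) * (D.numSites k : ℝ) := by
    calc ∑ t : Fin m × S.Dom, Real.exp (-(c t.1) - κ₁ * S.dj t.2)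
        ≤ (Fintype.card G.toCubeCover.Cube : ℝ) * B12TreeDecay.K₀ c₀ Δ * ∑ i, Real.exp (-(c i)) :=
          classWeightSum_le S G.toCubeCover c κ₁ _ (B12TreeDecay.hTree_of_volumeLeaf G hΔ hV hκ)
      _ = (Fintype.card G.toCubeCover.Cube : ℝ) * (B12TreeDecay.K₀ c₀ Δ * ∑ i, Real.exp (-(c i))) := by ring
      _ ≤ (πc * (D.numSites k : ℝ)) * (B12TreeDecay.K₀ c₀ Δ * ∑ i, Real.exp (-(c i))) :=
          mul_le_mul_of_nonneg_right hπ (mul_nonneg hK₀ hsum)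
      _ = (πc * B12TreeDecay.K₀ c₀ Δ * ∑ i, Real.exp (-(c i))) * (D.numSites k : ℝ) := by ring
  exact B16Cor3.uvIneq_of_structure D k R fam (fun t => Real.exp (-(c t.1) - κ₁ * S.dj t.2)) A' Rre E₁ ε E' _
    hH hU1 hinj (fun _ => (Real.exp_pos _).le) hmaj hE hL1 hform hχ hA' hR

/-! ## 2. Reading (β): tokens indexed by BIRTH scale — liveness, smallness, and the k-uniform entropy constant -/

/-- Reading (β): the regions present at step k indexed by their AGE `m = k − j ∈ [0, k]` (birth scale `j`), as in the
sum over admissible sequences `{Ω_j}, {Λ_j}` of (2.18) [III] and in [Balaban1982Higgs2] (3.41): for each age a system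
of scale-`j` localization domains `S m` and the finite set `live m` of those still LIVE at step k (within the
𝐑-horizon, p. 385: *"Thus K ≤ n₀ − j + R_j"*); a token is a pair (age, live domain of that age).  Finite. [cite: Balaban1989LargeFieldII, p.385 before (1.81)] -/
abbrev Tok {k : ℕ} (S : Fin (k + 1) → LocDomainSys) (live : (m : Fin (k + 1)) → Finset (S m).Dom) : Type :=
  Σ m : Fin (k + 1), ↥(live m)

/-- The weight of a token of age `m`: `exp(−c_m − κ·d_j(Y))` — small factor `e^{−c_m}` left to a region born `m` steps
ago ((1.79): creation factors `exp(−½γ₀A₁²p₀²(g_j)(d′_j + 1) − 2p₀(g_j))` minus the costs of (1.80)) and tree decay at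
its own scale (`κ`).  Roles only. [cite: Balaban1989LargeFieldII, (1.79) p.383] -/
noncomputable def wt {k : ℕ} (S : Fin (k + 1) → LocDomainSys) (live : (m : Fin (k + 1)) → Finset (S m).Dom)
    (c : Fin (k + 1) → ℝ) (κ : ℝ) (t : Tok S live) : ℝ :=
  Real.exp (-(c t.1) - κ * (S t.1).dj t.2.1)

/-- The weights are non-negative (hypothesis `hw` of `B16Cor3.uvIneq_of_structure`). [folklore] -/
theorem wt_nonneg {k : ℕ} (S : Fin (k + 1) → LocDomainSys) (live : (m : Fin (k + 1)) → Finset (S m).Dom)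
    (c : Fin (k + 1) → ℝ) (κ : ℝ) (t : Tok S live) : 0 ≤ wt S live c κ t :=
  (Real.exp_pos _).le

/-- **The SMALLNESS clause** of reading (β) (cell SMALLNESS.md S-B16.16; the prose of cell GAPS C-B16-9 *"L^{dm}π_{k−m}
… ≪ 1"*): for every LIVE token of age `m`, the volume growth `Λ^m` of the number of scale-`j` cubes per scale-`k` cube
(`Λ = L^d`, [I] p. 258) and one extra factor `e^{−m}` for the sum over ages are paid by the small factor `c_m` and by
the part `κ − κ₁` of the tree decay not reserved for the per-cube sum: `m(log Λ + 1) + q ≤ c_m + (κ − κ₁)d_j(Y)`.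
A hypothesis (discharged from a horizon in `smallness_of_horizon`). [cite: Balaban1989LargeFieldII, p.385 "K ≤ n₀ − j + R_j"] -/
def Smallness {k : ℕ} (S : Fin (k + 1) → LocDomainSys) (live : (m : Fin (k + 1)) → Finset (S m).Dom)
    (c : Fin (k + 1) → ℝ) (κ κ₁ Λ q : ℝ) : Prop :=
  ∀ (m : Fin (k + 1)) (Y : (S m).Dom), Y ∈ live m →
    ((m : ℕ) : ℝ) * (Real.log Λ + 1) + q ≤ c m + (κ - κ₁) * (S m).dj Y

/-- The volume cancellation: `exp(−m(log Λ + 1) − q)·Λ^m = e^{−q}(e^{−1})^m` for `Λ > 0`. [folklore] -/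
theorem exp_age_mul_pow (Λ : ℝ) (hΛ : 0 < Λ) (m : ℕ) (q : ℝ) :
    Real.exp (-((m : ℝ) * (Real.log Λ + 1)) - q) * Λ ^ m = Real.exp (-q) * Real.exp (-1) ^ m := by
  have h1 : Real.exp ((m : ℝ) * Real.log Λ) = Λ ^ m := by
    rw [Real.exp_nat_mul, Real.exp_log hΛ]
  rw [← h1, ← Real.exp_add, ← Real.exp_nat_mul, ← Real.exp_add]
  congr 1
  ring

/-- The sum over ages is geometric: `Σ_{m=0}^{k} e^{−m} ≤ (1 − e^{−1})⁻¹`, uniformly in `k`. [folklore] -/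
theorem ageGeomSum_le (k : ℕ) : ∑ m : Fin (k + 1), Real.exp (-1) ^ (m : ℕ) ≤ (1 - Real.exp (-1))⁻¹ := by
  rw [Fin.sum_univ_eq_sum_range (fun i => Real.exp (-1) ^ i) (k + 1)]
  have hx0 : 0 ≤ Real.exp (-1) := (Real.exp_pos _).le
  have hx1 : Real.exp (-1) < 1 := Real.exp_lt_one_iff.mpr (by norm_num)
  have hpos : 0 < 1 - Real.exp (-1) := by linarith
  have hmul := geom_sum_mul_neg (Real.exp (-1)) (k + 1)
  have hpow : 0 ≤ Real.exp (-1) ^ (k + 1) := pow_nonneg hx0 _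
  rw [inv_eq_one_div, le_div_iff₀ hpos, hmul]
  linarith

/-- **One age slice.**  Under the smallness clause for the live tokens of age `m` and the tree-decay input at their
scale with the reserved rate `κ₁` (`hTree`, [I] p. 257 / [II] (1.26)), `Σ_{Y live, age m} exp(−c_m − κd_j(Y)) ≤
exp(−m(log Λ + 1) − q)·|π_j|·K₀`.  (Each term: `exp(−c_m − κd) ≤ exp(−m(log Λ+1) − q)·exp(−κ₁d)` by smallness; then
the live tokens are among all domains and `B16Cor3.sum_le_card_mul`.) [cite: Balaban1989LargeFieldII, p.387 ll.8–12] -/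
theorem ageSliceSum_le {k : ℕ} (S : Fin (k + 1) → LocDomainSys) (G : (m : Fin (k + 1)) → B12TreeDecay.CubeSystem (S m))
    (live : (m : Fin (k + 1)) → Finset (S m).Dom) (c : Fin (k + 1) → ℝ) (κ κ₁ Λ q K₀ : ℝ) (m : Fin (k + 1))
    (hTree : ∀ cb : (G m).toCubeCover.Cube,
      ∑ X ∈ (G m).toCubeCover.above cb, Real.exp (-κ₁ * (S m).dj X) ≤ K₀)
    (hsm : ∀ Y ∈ live m, ((m : ℕ) : ℝ) * (Real.log Λ + 1) + q ≤ c m + (κ - κ₁) * (S m).dj Y) :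
    ∑ Y ∈ live m, Real.exp (-(c m) - κ * (S m).dj Y)
      ≤ Real.exp (-(((m : ℕ) : ℝ) * (Real.log Λ + 1)) - q) *
        ((Fintype.card (G m).toCubeCover.Cube : ℝ) * K₀) := by
  have hpt : ∀ Y ∈ live m, Real.exp (-(c m) - κ * (S m).dj Y)
      ≤ Real.exp (-(((m : ℕ) : ℝ) * (Real.log Λ + 1)) - q) * Real.exp (-κ₁ * (S m).dj Y) := by
    intro Y hY
    rw [← Real.exp_add]
    exact Real.exp_le_exp.mpr (by linarith [hsm Y hY])
  calc ∑ Y ∈ live m, Real.exp (-(c m) - κ * (S m).dj Y)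
      ≤ ∑ Y ∈ live m, Real.exp (-(((m : ℕ) : ℝ) * (Real.log Λ + 1)) - q) * Real.exp (-κ₁ * (S m).dj Y) :=
        Finset.sum_le_sum hpt
    _ = Real.exp (-(((m : ℕ) : ℝ) * (Real.log Λ + 1)) - q) * ∑ Y ∈ live m, Real.exp (-κ₁ * (S m).dj Y) := by
        rw [Finset.mul_sum]
    _ ≤ Real.exp (-(((m : ℕ) : ℝ) * (Real.log Λ + 1)) - q) * ∑ Y, Real.exp (-κ₁ * (S m).dj Y) :=
        mul_le_mul_of_nonneg_left
          (Finset.sum_le_univ_sum_of_nonneg fun Y => (Real.exp_pos _).le) (Real.exp_pos _).le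
    _ ≤ Real.exp (-(((m : ℕ) : ℝ) * (Real.log Λ + 1)) - q) *
          ((Fintype.card (G m).toCubeCover.Cube : ℝ) * K₀) :=
        mul_le_mul_of_nonneg_left
          (B16Cor3.sum_le_card_mul (G m).toCubeCover _ (fun _ => (Real.exp_pos _).le) K₀ hTree)
          (Real.exp_pos _).le

/-- The token sum IS the double sum over ages and live domains. [folklore] -/
theorem tokenSum_eq {k : ℕ} (S : Fin (k + 1) → LocDomainSys) (live : (m : Fin (k + 1)) → Finset (S m).Dom)
    (c : Fin (k + 1) → ℝ) (κ : ℝ) :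
    ∑ t : Tok S live, wt S live c κ t = ∑ m : Fin (k + 1), ∑ Y ∈ live m, Real.exp (-(c m) - κ * (S m).dj Y) := by
  rw [Fintype.sum_sigma]
  refine Finset.sum_congr rfl fun m _ => ?_
  rw [← Finset.sum_coe_sort (live m)]
  rfl

/-- **The k-UNIFORM entropy constant of reading (β).**  Tree decay with the reserved rate `κ₁` at every age
(`hTree`), cube counts `|π_j| ≤ πc·Λ^m·|T₁^{(k)}|` ([I] p. 258: `πc = M⁻⁴`, `Λ = L⁴`, `m = k − j`; hypothesis `hπ`, cell
GAPS C-adv3-6), and the smallness clause for every live token give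
`Σ_{tokens} w ≤ πc·K₀·e^{−q}·(1 − e^{−1})⁻¹·|T₁^{(k)}|` — the hypothesis `hE` of `B16Cor3.uvIneq_of_structure` with an
`Ep′` that does not depend on `k` (cell GAPS G-pv06-1 (B), C-B16-9, C-f2.7: "counts only while live … ≪ 1").
[cite: Balaban1989LargeFieldII, p.387 ll.8–12] -/
theorem tokenSum_le {k : ℕ} (S : Fin (k + 1) → LocDomainSys) (G : (m : Fin (k + 1)) → B12TreeDecay.CubeSystem (S m))
    (live : (m : Fin (k + 1)) → Finset (S m).Dom) (c : Fin (k + 1) → ℝ) (κ κ₁ Λ q K₀ πc N : ℝ)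
    (hΛ : 0 < Λ) (hK₀ : 0 ≤ K₀) (hπc : 0 ≤ πc) (hN : 0 ≤ N)
    (hTree : ∀ (m : Fin (k + 1)) (cb : (G m).toCubeCover.Cube),
      ∑ X ∈ (G m).toCubeCover.above cb, Real.exp (-κ₁ * (S m).dj X) ≤ K₀)
    (hπ : ∀ m : Fin (k + 1), (Fintype.card (G m).toCubeCover.Cube : ℝ) ≤ πc * Λ ^ (m : ℕ) * N)
    (hsm : Smallness S live c κ κ₁ Λ q) :
    ∑ t : Tok S live, wt S live c κ t ≤ πc * K₀ * Real.exp (-q) * (1 - Real.exp (-1))⁻¹ * N := by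
  have hslice : ∀ m : Fin (k + 1), ∑ Y ∈ live m, Real.exp (-(c m) - κ * (S m).dj Y)
      ≤ (πc * K₀ * Real.exp (-q) * N) * Real.exp (-1) ^ (m : ℕ) := by
    intro m
    refine (ageSliceSum_le S G live c κ κ₁ Λ q K₀ m (hTree m) (hsm m)).trans ?_
    have hcard : (Fintype.card (G m).toCubeCover.Cube : ℝ) * K₀ ≤ πc * Λ ^ (m : ℕ) * N * K₀ :=
      mul_le_mul_of_nonneg_right (hπ m) hK₀
    calc Real.exp (-(((m : ℕ) : ℝ) * (Real.log Λ + 1)) - q) * ((Fintype.card (G m).toCubeCover.Cube : ℝ) * K₀)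
        ≤ Real.exp (-(((m : ℕ) : ℝ) * (Real.log Λ + 1)) - q) * (πc * Λ ^ (m : ℕ) * N * K₀) :=
          mul_le_mul_of_nonneg_left hcard (Real.exp_pos _).le
      _ = (Real.exp (-(((m : ℕ) : ℝ) * (Real.log Λ + 1)) - q) * Λ ^ (m : ℕ)) * (πc * N * K₀) := by ring
      _ = (Real.exp (-q) * Real.exp (-1) ^ (m : ℕ)) * (πc * N * K₀) := by rw [exp_age_mul_pow Λ hΛ]
      _ = (πc * K₀ * Real.exp (-q) * N) * Real.exp (-1) ^ (m : ℕ) := by ring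
  have hA : 0 ≤ πc * K₀ * Real.exp (-q) * N := by positivity
  calc ∑ t : Tok S live, wt S live c κ t
      = ∑ m : Fin (k + 1), ∑ Y ∈ live m, Real.exp (-(c m) - κ * (S m).dj Y) := tokenSum_eq S live c κ
    _ ≤ ∑ m : Fin (k + 1), (πc * K₀ * Real.exp (-q) * N) * Real.exp (-1) ^ (m : ℕ) :=
        Finset.sum_le_sum fun m _ => hslice m
    _ = (πc * K₀ * Real.exp (-q) * N) * ∑ m : Fin (k + 1), Real.exp (-1) ^ (m : ℕ) := by rw [Finset.mul_sum]
    _ ≤ (πc * K₀ * Real.exp (-q) * N) * (1 - Real.exp (-1))⁻¹ :=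
        mul_le_mul_of_nonneg_left (ageGeomSum_le k) hA
    _ = πc * K₀ * Real.exp (-q) * (1 - Real.exp (-1))⁻¹ * N := by ring

/-- The k-uniform constant of reading (β): `Ep′ = πc·K₀(c₀,Δ)·e^{−q}·(1 − e^{−1})⁻¹`. [folklore] -/
noncomputable def EpScales (πc c₀ : ℝ) (Δ : ℕ) (q : ℝ) : ℝ :=
  πc * B12TreeDecay.K₀ c₀ Δ * Real.exp (-q) * (1 - Real.exp (-1))⁻¹

/-- **(2.50)/(0.1), one run, one step, reading (β)** — `B16Cor3.uvIneq_of_structure` with the region type `Tok S live`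
(live tokens indexed by age = birth scale), the weights `wt` (`exp(−c_m − κd_j(Y))`), the tree-decay input at EVERY
scale DISCHARGED BY NAME (`B12TreeDecay.hTree_of_volumeLeaf` with the same dimension-only constants `c₀, Δ` at all
scales, as in `B12TreeDecay.hTree_scales_of_volumeLeaf`; reserved rate `κ₁ ≥ κ₀(c₀,Δ)`), the cube counts `hπ` ([I]
p. 258) and the SMALLNESS clause `hsm`.  Conclusion: `B16.UVIneq` at every configuration with `E₋ = E₁ + ε`,
`E₊ = E′ + EpScales πc c₀ Δ q` — the entropy part of `E₊` is INDEPENDENT OF k.  The injective indexing `fam` of the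
summands of (2.18)/(1.72) by finite families of (age, live region) tokens and the majorisation `hmaj` are leaf U1
(hypotheses, as in `B16Cor3.uvIneq_of_structure`). [cite: Balaban1989LargeFieldII, (0.1) p.356 and p.387 ll.8–12] -/
theorem uvIneq_of_structure_scales (D : B16.RunData) (k : ℕ) (R : B14Cor3.TermData D k)
    (S : Fin (k + 1) → LocDomainSys) (G : (m : Fin (k + 1)) → B12TreeDecay.CubeSystem (S m))
    {Δ : ℕ} (hΔ : ∀ m, (G m).DegreeLE Δ) {c₀ : ℝ} (hV : ∀ m, (G m).VolumeLeaf c₀)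
    {κ₁ : ℝ} (hκ₁ : B12TreeDecay.kappa₀ c₀ Δ ≤ κ₁)
    (live : (m : Fin (k + 1)) → Finset (S m).Dom) (c : Fin (k + 1) → ℝ) (κ Λ q πc : ℝ)
    (hΛ : 0 < Λ) (hπc : 0 ≤ πc)
    (hπ : ∀ m : Fin (k + 1), (Fintype.card (G m).toCubeCover.Cube : ℝ) ≤ πc * Λ ^ (m : ℕ) * (D.numSites k : ℝ))
    (hsm : Smallness S live c κ κ₁ Λ q)
    (fam : R.Adm → Finset (Tok S live)) (A' Rre : D.Cfg k → ℝ) (E₁ ε E' : ℝ)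
    (hH : R.Holds)
    (hU1 : ∀ a V, R.term a V ≤ R.major a)
    (hinj : Function.Injective fam)
    (hmaj : ∀ a, R.major a ≤ Real.exp (E' * (D.numSites k : ℝ)) * ∏ t ∈ fam a, wt S live c κ t)
    (hL1 : ∀ a V, 0 ≤ R.term a V)
    (hform : ∀ V, R.term R.allSmall V = D.χ k V * Real.exp (A' V + Rre V))
    (hχ : ∀ V, 0 ≤ D.χ k V)
    (hA' : ∀ V, D.χ k V ≠ 0 →
      -(1 / (D.flow.g k) ^ 2 * D.wilsonBG k V) - E₁ * (D.numSites k : ℝ) ≤ A' V)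
    (hR : ∀ V, |Rre V| ≤ ε * (D.numSites k : ℝ)) :
    ∀ V : D.Cfg k, B16.UVIneq D k V (E₁ + ε) (E' + EpScales πc c₀ Δ q) := by
  have hE : ∑ t : Tok S live, wt S live c κ t ≤ EpScales πc c₀ Δ q * (D.numSites k : ℝ) :=
    tokenSum_le S G live c κ κ₁ Λ q (B12TreeDecay.K₀ c₀ Δ) πc (D.numSites k : ℝ) hΛ
      (B12TreeDecay.K₀_pos c₀ Δ).le hπc (Nat.cast_nonneg _)
      (fun m => B12TreeDecay.hTree_of_volumeLeaf (G m) (hΔ m) (hV m) hκ₁) hπ hsm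
  exact B16Cor3.uvIneq_of_structure D k R fam (wt S live c κ) A' Rre E₁ ε E' _ hH hU1 hinj
    (wt_nonneg S live c κ) hmaj hE hL1 hform hχ hA' hR

/-! ## 3. The smallness clause from a liveness HORIZON (p. 384–385) and from the printed profiles ((2.4)–(2.5) [III]) -/

/-- The size part of the horizon.  p. 384–385: *"d′_n(Z^{(n−j)}) ≤ … ≤ 2^{−(n−j)}d′_j(Z)"* and *"Let n₀ be the last
index n such that d′_n(Z^{(n−j)}) > 0"*: if a size that is at least `1` whenever positive (sizes count MR_n-cubes)
survives `n` halvings, `1 ≤ 2^{−n}·s₀`, then `n ≤ s₀` (indeed `n < 2^n ≤ s₀`).  So "n₀ − j" is at most the birth size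
`d′_j(Z)`: the `b·d_j(Y)` term of `smallness_of_horizon` (with the comparison of `d′_j` and `d_j` a hypothesis, cell
GAPS G-B16-08 (a)). [cite: Balaban1989LargeFieldII, p.384 last display and p.385 ll.3–7] -/
theorem age_le_size_of_halving (s₀ : ℝ) (n : ℕ) (h : 1 ≤ (1 / 2 : ℝ) ^ n * s₀) : (n : ℝ) ≤ s₀ := by
  have h2 : (0 : ℝ) < 2 ^ n := by positivity
  have hs : (2 : ℝ) ^ n ≤ s₀ := by
    have : (1 / 2 : ℝ) ^ n * s₀ = s₀ / 2 ^ n := by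
      rw [div_pow, one_pow, div_mul_eq_mul_div, one_mul]
    rw [this, le_div_iff₀ h2, one_mul] at h
    exact h
  have hn : (n : ℝ) ≤ 2 ^ n := by exact_mod_cast (Nat.lt_two_pow_self).le
  exact hn.trans hs

/-- **Smallness from a horizon.**  If every LIVE token of age `m` obeys a horizon of the printed shape "K ≤ n₀ − j +
R_j" (p. 385) — `m ≤ a + b·d_j(Y) + H_m` (`H_m` = the `R_j`-part for the birth scale `j = k − m`, `a + b·d_j(Y)` ⊇ the
size part `n₀ − j`, `age_le_size_of_halving`) —, the small factor pays the size-independent part,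
`c_m ≥ (log Λ + 1)(a + H_m) + q`, and the reserved tree decay pays the size-dependent part, `(log Λ + 1)·b ≤ κ − κ₁`,
then the smallness clause holds.  Arithmetic (`Λ ≥ 1`, `d_j ≥ 0`; no sign condition on `b` is needed). [cite: Balaban1989LargeFieldII, p.385 "K ≤ n₀ − j + R_j"] -/
theorem smallness_of_horizon {k : ℕ} (S : Fin (k + 1) → LocDomainSys) (live : (m : Fin (k + 1)) → Finset (S m).Dom)
    (c : Fin (k + 1) → ℝ) (κ κ₁ Λ q a b : ℝ) (H : Fin (k + 1) → ℝ) (hΛ : 1 ≤ Λ)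
    (hlive : ∀ (m : Fin (k + 1)) (Y : (S m).Dom), Y ∈ live m → ((m : ℕ) : ℝ) ≤ a + b * (S m).dj Y + H m)
    (hc : ∀ m : Fin (k + 1), (Real.log Λ + 1) * (a + H m) + q ≤ c m)
    (hκ : (Real.log Λ + 1) * b ≤ κ - κ₁) :
    Smallness S live c κ κ₁ Λ q := by
  intro m Y hY
  have hℓ : 0 ≤ Real.log Λ + 1 := by linarith [Real.log_nonneg hΛ]
  have hd : 0 ≤ (S m).dj Y := (S m).dj_nonneg Y
  have h1 : ((m : ℕ) : ℝ) * (Real.log Λ + 1) ≤ (a + b * (S m).dj Y + H m) * (Real.log Λ + 1) :=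
    mul_le_mul_of_nonneg_right (hlive m Y hY) hℓ
  have h2 : (Real.log Λ + 1) * b * (S m).dj Y ≤ (κ - κ₁) * (S m).dj Y :=
    mul_le_mul_of_nonneg_right hκ hd
  have h3 := hc m
  nlinarith [h1, h2, h3]

/-- **The exponent condition for the printed profiles.**  With `x = log g_j⁻²` ([III] (2.4): `p₀(g) = A₀x^{p₀}`;
(2.5): `R_j ≤ L·x^r`, `B16Improved189.Rj_le_L_mul_pow`), a small factor `c = t·x^{r+e+1}` dominates
`ℓ(n₀ + ρx^r) + q` (horizon part `H = ρx^r`, size-independent part `n₀`, per-step entropy `ℓ = log Λ + 1`) for EVERY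
`x ≥ x₀ = max{1, (ℓ(n₀ + ρ) + q)/t}` — an explicit threshold, i.e. "g_j sufficiently small" with the smallness depending
only on `(ℓ, n₀, ρ, q, t)`; the exponent of the small factor need only EXCEED that of the horizon (print: *"2p ≥ (d+1)r"*
[Balaban1982Higgs2] p. 594, *"We assume that 2p₁ − (d+5)r₀ > p₀"* p. 383, *"for p₀ large, and g₁ sufficiently small"*
p. 385; cell STEP.md A26).  Arithmetic: for `x ≥ 1` every term is `≤ (coefficient)·x^{r+e}` and `t·x ≥ ℓ(n₀+ρ) + q`. [cite: Balaban1988Convergent, (2.4)–(2.5) p.255] -/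
theorem profile_domination (ℓ n₀ ρ q t : ℝ) (r e : ℕ) (hℓ : 0 ≤ ℓ) (hn₀ : 0 ≤ n₀) (hρ : 0 ≤ ρ) (hq : 0 ≤ q)
    (ht : 0 < t) (x : ℝ) (hx : max 1 ((ℓ * (n₀ + ρ) + q) / t) ≤ x) :
    ℓ * (n₀ + ρ * x ^ r) + q ≤ t * x ^ (r + e + 1) := by
  have hx1 : 1 ≤ x := le_trans (le_max_left _ _) hx
  have hx0 : 0 ≤ x := le_trans zero_le_one hx1
  have hxt : (ℓ * (n₀ + ρ) + q) / t ≤ x := le_trans (le_max_right _ _) hx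
  have hxt' : ℓ * (n₀ + ρ) + q ≤ t * x := by
    rw [div_le_iff₀ ht] at hxt
    linarith [hxt]
  have hp0 : 1 ≤ x ^ (r + e) := one_le_pow₀ hx1
  have hpr : x ^ r ≤ x ^ (r + e) := pow_le_pow_right₀ hx1 (Nat.le_add_right r e)
  have hpe : 0 ≤ x ^ (r + e) := pow_nonneg hx0 _
  have hL : ℓ * (n₀ + ρ * x ^ r) + q ≤ (ℓ * (n₀ + ρ) + q) * x ^ (r + e) := by
    have e1 : ℓ * n₀ ≤ ℓ * n₀ * x ^ (r + e) := by
      have := mul_le_mul_of_nonneg_left hp0 (mul_nonneg hℓ hn₀)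
      simpa using this
    have e2 : ℓ * (ρ * x ^ r) ≤ ℓ * ρ * x ^ (r + e) := by
      have := mul_le_mul_of_nonneg_left hpr (mul_nonneg hℓ hρ)
      calc ℓ * (ρ * x ^ r) = ℓ * ρ * x ^ r := by ring
        _ ≤ ℓ * ρ * x ^ (r + e) := this
    have e3 : q ≤ q * x ^ (r + e) := by
      have := mul_le_mul_of_nonneg_left hp0 hq
      simpa using this
    calc ℓ * (n₀ + ρ * x ^ r) + q = ℓ * n₀ + ℓ * (ρ * x ^ r) + q := by ring
      _ ≤ ℓ * n₀ * x ^ (r + e) + ℓ * ρ * x ^ (r + e) + q * x ^ (r + e) := by linarith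
      _ = (ℓ * (n₀ + ρ) + q) * x ^ (r + e) := by ring
  calc ℓ * (n₀ + ρ * x ^ r) + q ≤ (ℓ * (n₀ + ρ) + q) * x ^ (r + e) := hL
    _ ≤ (t * x) * x ^ (r + e) := mul_le_mul_of_nonneg_right hxt' hpe
    _ = t * x ^ (r + e + 1) := by ring

/-- The same with exponents `r < p` (the only relation the position entropy of reading (β) needs). [cite: Balaban1988Convergent, (2.4)–(2.5) p.255] -/
theorem profile_domination_of_lt (ℓ n₀ ρ q t : ℝ) {r p : ℕ} (hrp : r < p) (hℓ : 0 ≤ ℓ) (hn₀ : 0 ≤ n₀)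
    (hρ : 0 ≤ ρ) (hq : 0 ≤ q) (ht : 0 < t) (x : ℝ) (hx : max 1 ((ℓ * (n₀ + ρ) + q) / t) ≤ x) :
    ℓ * (n₀ + ρ * x ^ r) + q ≤ t * x ^ p := by
  obtain ⟨e, rfl⟩ := Nat.exists_eq_add_of_lt hrp
  exact profile_domination ℓ n₀ ρ q t r e hℓ hn₀ hρ hq ht x hx

/-- "g_j ≤ γ with γ sufficiently small" delivers the threshold at every birth scale: for `0 < g ≤ γ`,
`log g⁻² ≥ log γ⁻²`, so `x₀ ≤ log γ⁻²` (a condition on γ alone) gives `x₀ ≤ log g_j⁻²` for all `j`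
(`Setup.Flow.InInterval`). [folklore] -/
theorem threshold_of_coupling_le (x₀ γ g : ℝ) (hg : 0 < g) (hgγ : g ≤ γ) (hγ : x₀ ≤ Real.log (γ ^ 2)⁻¹) :
    x₀ ≤ Real.log (g ^ 2)⁻¹ := by
  have hγ0 : 0 < γ := lt_of_lt_of_le hg hgγ
  refine hγ.trans (Real.log_le_log (by positivity) ?_)
  have h2 : g ^ 2 ≤ γ ^ 2 := pow_le_pow_left₀ hg.le hgγ 2
  exact inv_anti₀ (by positivity) h2

/-- **Reading (β) from a horizon**: `uvIneq_of_structure_scales` with the smallness clause DISCHARGED by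
`smallness_of_horizon` — the located inputs are then exactly: the liveness horizon of every token (`hlive`, p. 385
"K ≤ n₀ − j + R_j" with its size part as `a + b·d_j`), the small factors left to live tokens (`hc`, (1.79)/(1.80) net of
costs, with the exponent condition certified by `profile_domination_of_lt` for the printed profiles), the reserve
`(log Λ + 1)b ≤ κ − κ₁` of tree decay ("κ sufficiently large", [II] (1.26)), the cube counts `hπ` ([I] p. 258), and
leaf U1 (`fam`, `hinj`, `hmaj`). [cite: Balaban1989LargeFieldII, (0.1) p.356 and p.385] -/
theorem uvIneq_of_structure_horizon (D : B16.RunData) (k : ℕ) (R : B14Cor3.TermData D k)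
    (S : Fin (k + 1) → LocDomainSys) (G : (m : Fin (k + 1)) → B12TreeDecay.CubeSystem (S m))
    {Δ : ℕ} (hΔ : ∀ m, (G m).DegreeLE Δ) {c₀ : ℝ} (hV : ∀ m, (G m).VolumeLeaf c₀)
    {κ₁ : ℝ} (hκ₁ : B12TreeDecay.kappa₀ c₀ Δ ≤ κ₁)
    (live : (m : Fin (k + 1)) → Finset (S m).Dom) (c : Fin (k + 1) → ℝ) (κ Λ q πc a b : ℝ)
    (H : Fin (k + 1) → ℝ) (hΛ : 1 ≤ Λ) (hπc : 0 ≤ πc)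
    (hπ : ∀ m : Fin (k + 1), (Fintype.card (G m).toCubeCover.Cube : ℝ) ≤ πc * Λ ^ (m : ℕ) * (D.numSites k : ℝ))
    (hlive : ∀ (m : Fin (k + 1)) (Y : (S m).Dom), Y ∈ live m → ((m : ℕ) : ℝ) ≤ a + b * (S m).dj Y + H m)
    (hc : ∀ m : Fin (k + 1), (Real.log Λ + 1) * (a + H m) + q ≤ c m)
    (hκ : (Real.log Λ + 1) * b ≤ κ - κ₁)
    (fam : R.Adm → Finset (Tok S live)) (A' Rre : D.Cfg k → ℝ) (E₁ ε E' : ℝ)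
    (hH : R.Holds)
    (hU1 : ∀ a V, R.term a V ≤ R.major a)
    (hinj : Function.Injective fam)
    (hmaj : ∀ a, R.major a ≤ Real.exp (E' * (D.numSites k : ℝ)) * ∏ t ∈ fam a, wt S live c κ t)
    (hL1 : ∀ a V, 0 ≤ R.term a V)
    (hform : ∀ V, R.term R.allSmall V = D.χ k V * Real.exp (A' V + Rre V))
    (hχ : ∀ V, 0 ≤ D.χ k V)
    (hA' : ∀ V, D.χ k V ≠ 0 →
      -(1 / (D.flow.g k) ^ 2 * D.wilsonBG k V) - E₁ * (D.numSites k : ℝ) ≤ A' V)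
    (hR : ∀ V, |Rre V| ≤ ε * (D.numSites k : ℝ)) :
    ∀ V : D.Cfg k, B16.UVIneq D k V (E₁ + ε) (E' + EpScales πc c₀ Δ q) :=
  uvIneq_of_structure_scales D k R S G hΔ hV hκ₁ live c κ Λ q πc (lt_of_lt_of_le one_pos hΛ) hπc hπ
    (smallness_of_horizon S live c κ κ₁ Λ q a b H hΛ hlive hc hκ) fam A' Rre E₁ ε E' hH hU1 hinj hmaj hL1
    hform hχ hA' hR

end Literature.MathematicalPhysics.QuantumFieldTheory.Balaban1983to89.B16Cor3Scales
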